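import Summits.QuantumFields.YangMills.Theorems.UnitScaleTiltHalvingP1FlatCoreFrameLinOsc
import HarnessLib

/-!
# The effective-gauge tower in log coordinates: the `k`-UNIFORM size row (J-N05♭ `core′`, induction brick F2b)

Sub-problem `YangMills` of summit `QuantumFields`; route `UnitScaleTilt`, line H = `BirthV10.stub_halvingStep`, pillar P1♭ `core′`
(LEAD-H T2♭-PLAN v1.1; rulings L-3/L-4/L-5; LEAD-H 11:30:32Z/11:36:33Z: general step ✓`effGauge_step_eq_eml_G`).  Helper file
(`--supports stmt-QuantumFields-19200 --as helper`); it closes no item.  HONEST LABEL: YM₃ on `T³` is rung R3 of the ladder, NOT the Clay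
problem; nothing here is a mass-gap statement.

## What this file adds

The summation of the oscillation-sensitive step ✓`P1FlatCoreFrameLinOsc.norm_mlog_effGauge_succ_sub_siteAvg_le` along the double-bar
tower of a GENERAL level-`0` field `W`: if `κ_0 = exp ∘ l₀` with `‖l₀‖ ≤ a`, every centre stair of every `U̿^{(j)}W`, `j < k`, is within
`δ` of `1`, and the LINEAR iterates oscillate geometrically from the top,
`‖(Q′_j l₀)(x_idx) − (Q′_j l₀)(ȳ)‖ ≤ ω·2^{j+1}/2^k` (the (1.120) gradient row of the family contraction, in torus letters), then for
`160(a + δ + 5ω) ≤ 1/4` every level is again `exp ∘ log` and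
`‖log κ_k(y) − (Q′_k l₀)(y)‖ ≤ 640·(a + δ + 5ω)·ω` — with a constant that does NOT depend on `k` (the (1.121) size row of
✓`B8SectEKLevelFamily`'s `hC121` with `α₃ ↦ α₃ + δ̄`, LEAD-H 11:30:32Z).  The invariant of the induction is itself geometric:
the level-`j` deviation is `≤ 4εω·2^j/2^k`, `ε = 160(a + δ + 5ω)` — errors born at lower levels are forgotten at rate `(1+2ε)/2 < 1`.

[cite: Balaban1985RegularSpaces, Sect. E (1.120)-(1.121) pp.95-96; Balaban1985Averaging, (97)-(100) p.32, (110) p.34; Balaban1984PropagatorsI, (1.13), (1.20) pp.19-20]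
-/

noncomputable section

open NormedSpace
open Literature.MathematicalPhysics.QuantumFieldTheory.Balaban1983to89
open T4Continuum BlockAveraging ExpMeanLog MatrixLog
open B10Eq27TorusAxialLog (holT gaugeActT)
open B7TransferAnalyticMean (meanCLM meanCLM_apply norm_meanCLM_apply_le)
open LatticeFieldCalculus (siteAvg siteAvgIter)
open Summit.QuantumFields.YangMills.Theorems.Prop8ChartDoubleBar (vframeU dbarIterU)
open Summit.QuantumFields.YangMills.Theorems.P1FlatCoreFrameLinBCH (norm_meanCLM_le_of_forall_le)
open Summit.QuantumFields.YangMills.Theorems.P1FlatCoreFrameLin (meanCLM_stairEnd_eq_siteAvg)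
open Summit.QuantumFields.YangMills.Theorems.P1FlatCoreFrameLinOsc (norm_mlog_effGauge_succ_sub_siteAvg_le exp_mlog_effGauge_succ)

namespace Summit.QuantumFields.YangMills.Theorems.P1FlatCoreFrameLinTowerSum

variable {𝔸 : Type*} [NormedRing 𝔸] [NormedAlgebra ℂ 𝔸] [CompleteSpace 𝔸]
variable {P : Params}

/-! ## §1 Sup bounds are preserved by the block site-average -/

section SiteAvg

variable {j : ℕ}

omit [CompleteSpace 𝔸] in
/-- **THE BLOCK SITE-AVERAGE DOES NOT INCREASE THE SUP NORM**: `‖f‖ ≤ r` on the stair ends of the block of `y` ⇒ `‖(Q′f)(y)‖ ≤ r`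
(the average is the uniform mean over the stair ends, ✓`meanCLM_stairEnd_eq_siteAvg`). [cite: Balaban1984PropagatorsI, (1.13) p.19] -/
theorem norm_siteAvg_le (f : Site P j → 𝔸) (y : Site P (j + 1)) {r : ℝ} (hr : 0 ≤ r)
    (h : ∀ idx : Idx P, ‖f (walkEnd (emb y) (stairWord idx.2.1 (off idx.1)))‖ ≤ r) : ‖siteAvg f y‖ ≤ r := by
  rw [← meanCLM_stairEnd_eq_siteAvg f y]
  exact norm_meanCLM_le_of_forall_le _ hr h

omit [CompleteSpace 𝔸] in
/-- **DIFFERENCES UNDER THE BLOCK SITE-AVERAGE**: `‖f − g‖ ≤ r` on the stair ends of the block of `y` ⇒ `‖(Q′f)(y) − (Q′g)(y)‖ ≤ r`.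
[cite: Balaban1984PropagatorsI, (1.13) p.19] -/
theorem norm_siteAvg_sub_siteAvg_le (f g : Site P j → 𝔸) (y : Site P (j + 1)) {r : ℝ} (hr : 0 ≤ r)
    (h : ∀ idx : Idx P, ‖f (walkEnd (emb y) (stairWord idx.2.1 (off idx.1))) - g (walkEnd (emb y) (stairWord idx.2.1 (off idx.1)))‖ ≤ r) :
    ‖siteAvg f y - siteAvg g y‖ ≤ r := by
  rw [← meanCLM_stairEnd_eq_siteAvg f y, ← meanCLM_stairEnd_eq_siteAvg g y, ← map_sub]
  exact norm_meanCLM_le_of_forall_le _ hr h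

omit [CompleteSpace 𝔸] in
/-- **THE ITERATED SITE-AVERAGE DOES NOT INCREASE THE SUP NORM**: `‖l₀‖ ≤ a` everywhere ⇒ `‖Q′_j l₀‖ ≤ a` everywhere.
[cite: Balaban1984PropagatorsI, (1.20) p.20] -/
theorem norm_siteAvgIter_le (l₀ : Site P 0 → 𝔸) {a : ℝ} (ha : 0 ≤ a) (h : ∀ x, ‖l₀ x‖ ≤ a) :
    ∀ (j : ℕ) (y : Site P j), ‖siteAvgIter j l₀ y‖ ≤ a
  | 0, y => h y
  | j + 1, y => norm_siteAvg_le (siteAvgIter j l₀) y ha fun _ => norm_siteAvgIter_le l₀ ha h j _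

end SiteAvg

/-! ## §2 The arithmetic of one induction step -/

section Arith

/-- **THE STEP ARITHMETIC**: with `ε := 160(a + δ + 5ω) ≤ 1/4`, `0 ≤ t ≤ 1`, a level deviation `d ≤ 4εω·t` and a linear oscillation
`m′ ≤ 2ω·t`, the next deviation `160(a + d + δ + (m′ + 2d))·(m′ + 2d) + d` is `≤ 4εω·(2t)` — the geometric invariant propagates
(`(1 + 2ε)·4 + 2 ≤ 8`). [folklore] -/
theorem step_arith {a δ ω t d m' : ℝ} (ha : 0 ≤ a) (hδ : 0 ≤ δ) (hω : 0 ≤ ω) (ht0 : 0 ≤ t) (ht1 : t ≤ 1) (hd0 : 0 ≤ d)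
    (hd : d ≤ 4 * (160 * (a + δ + 5 * ω)) * ω * t) (hm0 : 0 ≤ m') (hm : m' ≤ 2 * ω * t) (hε : 160 * (a + δ + 5 * ω) ≤ 1 / 4) :
    160 * (a + d + δ + (m' + 2 * d)) * (m' + 2 * d) + d ≤ 4 * (160 * (a + δ + 5 * ω)) * ω * (2 * t) := by
  set ε : ℝ := 160 * (a + δ + 5 * ω) with hεdef
  have hε0 : 0 ≤ ε := by positivity
  have hωt : 0 ≤ ω * t := mul_nonneg hω ht0
  have hωt1 : ω * t ≤ ω := by nlinarith
  -- `d ≤ ωt`, hence the prefactor is `≤ a + δ + 5ω`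
  have hd1 : d ≤ ω * t := by nlinarith
  have hM0 : 0 ≤ m' + 2 * d := by positivity
  have hM : m' + 2 * d ≤ 2 * ω * t + 2 * d := by linarith
  have hp : a + d + δ + (m' + 2 * d) ≤ a + δ + 5 * ω := by nlinarith
  have hp0 : 0 ≤ a + d + δ + (m' + 2 * d) := by positivity
  -- `160·p·M ≤ ε·M ≤ ε(2ωt + 2d)`
  have h1 : 160 * (a + d + δ + (m' + 2 * d)) * (m' + 2 * d) ≤ ε * (2 * ω * t + 2 * d) := by
    calc 160 * (a + d + δ + (m' + 2 * d)) * (m' + 2 * d) ≤ 160 * (a + δ + 5 * ω) * (m' + 2 * d) := by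
          apply mul_le_mul_of_nonneg_right _ hM0; linarith
      _ ≤ 160 * (a + δ + 5 * ω) * (2 * ω * t + 2 * d) := mul_le_mul_of_nonneg_left hM (by positivity)
      _ = ε * (2 * ω * t + 2 * d) := by rw [hεdef]
  -- `(1 + 2ε)d + 2εωt ≤ (1 + 2ε)·4εωt + 2εωt ≤ 8εωt`
  have h2 : (1 + 2 * ε) * d ≤ (1 + 2 * ε) * (4 * ε * ω * t) := mul_le_mul_of_nonneg_left hd (by positivity)
  have h3 : ε * ε * (ω * t) ≤ 1 / 4 * ε * (ω * t) := by
    apply mul_le_mul_of_nonneg_right _ hωt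
    nlinarith
  nlinarith

end Arith

/-! ## §3 The tower: the `k`-uniform size row (1.121) in torus letters -/

section Tower

/-- **★★★ THE EFFECTIVE-GAUGE TOWER IN LOG COORDINATES, `k`-UNIFORM**: let `κ` be the effective gauges of the double-bar tower of a
level-`0` field `W` (recursion `κ_{j+1}(y) = v(X_j^{κ_j})(y)⁻¹ κ_j(ȳ) v(X_j)(y)`, `X_j = U̿^{(j)}W`, ✓`exists_effGauge`) with
`κ_0 = exp ∘ l₀`, `‖l₀‖ ≤ a`; let every centre stair of every `X_j`, `j < k`, satisfy `‖X_j(Γ_{ȳ,x_idx}) − 1‖ ≤ δ`, and let the LINEAR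
iterates oscillate geometrically from the top, `‖(Q′_j l₀)(x_idx) − (Q′_j l₀)(ȳ)‖ ≤ ω·2^{j+1}/2^k` (`j < k`, every block); assume
`160(a + δ + 5ω) ≤ 1/4`.  Then at every level `j ≤ k`:  `κ_j = exp ∘ log ∘ κ_j` and
`‖log κ_j(y) − (Q′_j l₀)(y)‖ ≤ 4·160(a + δ + 5ω)·ω·2^j/2^k` — in particular at the top
`‖log κ_k − Q′_k l₀‖ ≤ 640·(a + δ + 5ω)·ω`, a bound whose constant does NOT depend on `k` (the (1.121) size row, `α₃ ↦ α₃ + δ̄`).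
[cite: Balaban1985RegularSpaces, Sect. E (1.120)-(1.121) pp.95-96; Balaban1985Averaging, (97)-(100) p.32, (110) p.34] -/
theorem exp_mlog_and_norm_mlog_effGauge_sub_siteAvgIter_le [Nonempty (Idx P)] (W : GaugeField P 0 𝔸ˣ)
    (κ : (i : ℕ) → GaugeTransf P i 𝔸ˣ)
    (hs : ∀ (i : ℕ) (y : Site P (i + 1)),
      κ (i + 1) y = (vframeU (gaugeActT (κ i) (dbarIterU i W)) y)⁻¹ * κ i (emb y) * vframeU (dbarIterU i W) y)
    (l₀ : Site P 0 → 𝔸) (hκ0 : ∀ x, ((κ 0 x : 𝔸ˣ) : 𝔸) = exp (l₀ x)) {a δ ω : ℝ} (hδ : 0 ≤ δ) (hω : 0 ≤ ω)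
    (ha : ∀ x, ‖l₀ x‖ ≤ a) (k : ℕ)
    (hH : ∀ j < k, ∀ (y : Site P (j + 1)) (idx : Idx P),
      ‖((holT (dbarIterU j W) (emb y) (stairWord idx.2.1 (off idx.1)) : 𝔸ˣ) : 𝔸) - 1‖ ≤ δ)
    (hosc : ∀ j < k, ∀ (y : Site P (j + 1)) (idx : Idx P),
      ‖siteAvgIter j l₀ (walkEnd (emb y) (stairWord idx.2.1 (off idx.1))) - siteAvgIter j l₀ (emb y)‖ ≤ ω * 2 ^ (j + 1) / 2 ^ k)
    (hr : 160 * (a + δ + 5 * ω) ≤ 1 / 4) :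
    ∀ j ≤ k, ∀ y : Site P j, exp (mlog ((κ j y : 𝔸ˣ) : 𝔸)) = ((κ j y : 𝔸ˣ) : 𝔸) ∧
      ‖mlog ((κ j y : 𝔸ˣ) : 𝔸) - siteAvgIter j l₀ y‖ ≤ 4 * (160 * (a + δ + 5 * ω)) * ω * (2 ^ j / 2 ^ k) := by
  have ha0 : 0 ≤ a := (norm_nonneg _).trans (ha (emb (Classical.arbitrary (Site P 1))))
  set ε : ℝ := 160 * (a + δ + 5 * ω) with hε
  have hε0 : 0 ≤ ε := by positivity
  have h2k : (0 : ℝ) < 2 ^ k := by positivity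
  intro j
  induction j with
  | zero =>
    intro _ y
    have hlt : ‖l₀ y‖ < Real.log 2 := by linarith [ha y, Real.log_two_gt_d9]
    refine ⟨by rw [hκ0, B7BlockAvgLog.mlog_exp hlt], ?_⟩
    rw [hκ0, B7BlockAvgLog.mlog_exp hlt]
    show ‖l₀ y - l₀ y‖ ≤ _
    rw [sub_self, norm_zero]; positivity
  | succ j ih =>
    intro hjk y
    have hj : j < k := Nat.lt_of_succ_le hjk
    have ihj := ih hj.le
    -- the geometric weights `t = 2^j/2^k ≤ 1/2`
    set t : ℝ := 2 ^ j / 2 ^ k with ht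
    have ht0 : 0 ≤ t := by positivity
    have ht1 : t ≤ 1 := by
      rw [ht, div_le_one h2k]; exact pow_le_pow_right₀ (by norm_num) hj.le
    have ht2 : (2 : ℝ) ^ (j + 1) / 2 ^ k = 2 * t := by rw [ht, pow_succ]; ring
    have ht2' : ω * 2 ^ (j + 1) / 2 ^ k = 2 * ω * t := by rw [ht, pow_succ]; ring
    -- level-`j` logs and their sizes
    set l : Site P j → 𝔸 := fun x => mlog ((κ j x : 𝔸ˣ) : 𝔸) with hl
    have hκ : ∀ x, ((κ j x : 𝔸ˣ) : 𝔸) = exp (l x) := fun x => ((ihj x).1).symm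
    set d : ℝ := 4 * ε * ω * t with hd
    have hd0 : 0 ≤ d := by positivity
    have hdev : ∀ x, ‖l x - siteAvgIter j l₀ x‖ ≤ d := fun x => (ihj x).2
    have hdω : d ≤ ω * t := by
      rw [hd]; nlinarith [mul_nonneg hω ht0]
    have hsize : ∀ x, ‖l x‖ ≤ a + d := fun x =>
      calc ‖l x‖ = ‖(l x - siteAvgIter j l₀ x) + siteAvgIter j l₀ x‖ := by rw [sub_add_cancel]
        _ ≤ d + a := (norm_add_le _ _).trans (add_le_add (hdev x) (norm_siteAvgIter_le l₀ ha0 ha j x))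
        _ = a + d := add_comm _ _
    have hoscl : ∀ idx : Idx P, ‖l (walkEnd (emb y) (stairWord idx.2.1 (off idx.1))) - l (emb y)‖ ≤ ω * 2 ^ (j + 1) / 2 ^ k + 2 * d := by
      intro idx
      have e1 := hdev (walkEnd (emb y) (stairWord idx.2.1 (off idx.1)))
      have e2 := hdev (emb y)
      have e3 := hosc j hj y idx
      calc _ = ‖(l (walkEnd (emb y) (stairWord idx.2.1 (off idx.1))) - siteAvgIter j l₀ (walkEnd (emb y) (stairWord idx.2.1 (off idx.1))))
            + (siteAvgIter j l₀ (walkEnd (emb y) (stairWord idx.2.1 (off idx.1))) - siteAvgIter j l₀ (emb y))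
            - (l (emb y) - siteAvgIter j l₀ (emb y))‖ := by congr 1; abel
        _ ≤ d + ω * 2 ^ (j + 1) / 2 ^ k + d := by
            refine (norm_sub_le _ _).trans (add_le_add ((norm_add_le _ _).trans (add_le_add e1 e3)) e2)
        _ = _ := by ring
    have hm0 : 0 ≤ ω * 2 ^ (j + 1) / 2 ^ k := by positivity
    -- the smallness of the step at this level
    have hrj : 2 * (a + d) + 4 * δ + 8 * (ω * 2 ^ (j + 1) / 2 ^ k + 2 * d) ≤ 1 / 16 := by
      rw [ht2']; nlinarith [mul_nonneg hω ht0]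
    have hstep := norm_mlog_effGauge_succ_sub_siteAvg_le W κ hs j y l hκ hδ (hH j hj y) (hsize (emb y)) (fun idx => hsize _) hoscl hrj
    have hexp := exp_mlog_effGauge_succ W κ hs j y l hκ hδ (hH j hj y) (hsize (emb y)) (fun idx => hsize _) hoscl hrj
    refine ⟨hexp.1, ?_⟩
    -- deviation at level `j+1`: step error + averaged deviation of level `j`
    have havg : ‖siteAvg l y - siteAvgIter (j + 1) l₀ y‖ ≤ d := by
      show ‖siteAvg l y - siteAvg (siteAvgIter j l₀) y‖ ≤ d
      exact norm_siteAvg_sub_siteAvg_le _ _ y hd0 fun idx => hdev _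
    have harith := step_arith ha0 hδ hω ht0 ht1 hd0 (le_of_eq hd) hm0 (le_of_eq ht2') hr
    calc ‖mlog ((κ (j + 1) y : 𝔸ˣ) : 𝔸) - siteAvgIter (j + 1) l₀ y‖
        = ‖(mlog ((κ (j + 1) y : 𝔸ˣ) : 𝔸) - siteAvg l y) + (siteAvg l y - siteAvgIter (j + 1) l₀ y)‖ := by rw [sub_add_sub_cancel]
      _ ≤ 160 * (a + d + δ + (ω * 2 ^ (j + 1) / 2 ^ k + 2 * d)) * (ω * 2 ^ (j + 1) / 2 ^ k + 2 * d) + d :=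
          (norm_add_le _ _).trans (add_le_add hstep havg)
      _ ≤ 4 * ε * ω * (2 * t) := harith
      _ = 4 * (160 * (a + δ + 5 * ω)) * ω * (2 ^ (j + 1) / 2 ^ k) := by rw [hε, ht2]

/-- **★★★ THE TOP-LEVEL SIZE ROW (1.121), `k`-UNIFORM**: under the hypotheses of ✓`exp_mlog_and_norm_mlog_effGauge_sub_siteAvgIter_le`,
`‖log κ_k(y) − (Q′_k l₀)(y)‖ ≤ 640·(a + δ + 5ω)·ω` for every top site `y` — the nonlinear part of the `k`-fold effective gauge map is
`(sizes) × (top oscillation)`, with a constant independent of `k`. [cite: Balaban1985RegularSpaces, Sect. E (1.121) p.96] -/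
theorem norm_mlog_effGauge_top_sub_siteAvgIter_le [Nonempty (Idx P)] (W : GaugeField P 0 𝔸ˣ)
    (κ : (i : ℕ) → GaugeTransf P i 𝔸ˣ)
    (hs : ∀ (i : ℕ) (y : Site P (i + 1)),
      κ (i + 1) y = (vframeU (gaugeActT (κ i) (dbarIterU i W)) y)⁻¹ * κ i (emb y) * vframeU (dbarIterU i W) y)
    (l₀ : Site P 0 → 𝔸) (hκ0 : ∀ x, ((κ 0 x : 𝔸ˣ) : 𝔸) = exp (l₀ x)) {a δ ω : ℝ} (hδ : 0 ≤ δ) (hω : 0 ≤ ω)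
    (ha : ∀ x, ‖l₀ x‖ ≤ a) (k : ℕ)
    (hH : ∀ j < k, ∀ (y : Site P (j + 1)) (idx : Idx P),
      ‖((holT (dbarIterU j W) (emb y) (stairWord idx.2.1 (off idx.1)) : 𝔸ˣ) : 𝔸) - 1‖ ≤ δ)
    (hosc : ∀ j < k, ∀ (y : Site P (j + 1)) (idx : Idx P),
      ‖siteAvgIter j l₀ (walkEnd (emb y) (stairWord idx.2.1 (off idx.1))) - siteAvgIter j l₀ (emb y)‖ ≤ ω * 2 ^ (j + 1) / 2 ^ k)
    (hr : 160 * (a + δ + 5 * ω) ≤ 1 / 4) (y : Site P k) :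
    exp (mlog ((κ k y : 𝔸ˣ) : 𝔸)) = ((κ k y : 𝔸ˣ) : 𝔸) ∧ ‖mlog ((κ k y : 𝔸ˣ) : 𝔸) - siteAvgIter k l₀ y‖ ≤ 640 * (a + δ + 5 * ω) * ω := by
  have h := exp_mlog_and_norm_mlog_effGauge_sub_siteAvgIter_le W κ hs l₀ hκ0 hδ hω ha k hH hosc hr k le_rfl y
  have h2k : (2 : ℝ) ^ k / 2 ^ k = 1 := div_self (by positivity)
  rw [h2k] at h
  refine ⟨h.1, h.2.trans (le_of_eq (by ring))⟩

end Tower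

end Summit.QuantumFields.YangMills.Theorems.P1FlatCoreFrameLinTowerSum

end
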